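import Summits.CriticalPhenomena.PercolationContinuityZ3.Theorems.PercNearOneGluingNoHeavyQuantPairCompleting
import Summits.CriticalPhenomena.PercolationContinuityZ3.Theorems.PercNearOneGluingNoHeavyQuantDIBStarFSE
import Summits.CriticalPhenomena.PercolationContinuityZ3.Theorems.PercNearOneGluingNoHeavyQuantDIBStarFloorSplitInductionCore
import HarnessLib

/-!
# QUANT lane R8, Conjecture DIB\* — THE RESIDUAL CLASS after the pairwise-completing family: `StepLemmaFSResidual` and `FSEResidual` TYPED,
# `StepLemmaFSResidual ↔ ∀ x < 1, DIBStar x`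

builds on p205010 (kernel theorem, internal audit signed; external expert review pending)

Statement + support file (`--supports stmt-CriticalPhenomena-4575`), QUANT lane typer seat prim-quant-stmt (gen 20), rung R8 of
`run/shared/lean/prim/quant/LADDER.md`.  TWO `Prop` definitions (the `@[conjecture]`s `StepLemmaFSResidual`, `FSEResidual`), theorems otherwise; no
sorries, standard axioms.  Companion of the lead's `…QuantDIBStarFloorSplitInductionCore` (g18, `StepLemmaFSCore ↔ ∀ x<1, DIBStar x`: the hard class =
floor `1/2 < x < 1`, sizes `≤ j`, heavy total `≤ 2j`, two non-empty lights, light total `≥ j+1`, no dead light, largest blob not sure, credit `> 2j`) and `…QuantDIBStarFSE` (`FSE`), and of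
this seat's `…QuantPairCompleting` (`tail_ge_of_pairCompleting`: DIB\* is KERNEL whenever every two non-empty blobs complete, `j + 1 ≤ a k + a l`).

So the hard class may further be assumed to contain TWO NON-EMPTY BLOBS THAT DO NOT COMPLETE (`a k₁ + a k₂ ≤ j`; in particular `≥ 4` non-empty
blobs of which at least one has `2·a ≤ j`):

* `Quant.IndepBlob.StepLemmaFSResidual` (`@[conjecture]`) — the lead's `StepLemmaFSCore` (g18) + `∃ k₁ ≠ k₂, 0 < a k₁ ∧ 0 < a k₂ ∧ a k₁ + a k₂ ≤ j`.
* `Quant.IndepBlob.FSEResidual` (`@[conjecture]`) — the lead's closed-form `FSE` with the same extra hypothesis.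
* **`stepLemmaFSCore_of_residual : StepLemmaFSResidual → StepLemmaFSCore`** (the complement is `tail_ge_of_pairCompleting`),
  `stepLemmaFSResidual_of_dibStar`, `dibStar_of_stepLemmaFSResidual`, **`stepLemmaFSResidual_iff_dibStar`**.
* `fseResidual_of_fse : FSE → FSEResidual`, **`stepLemmaFSResidual_of_fseResidual : FSEResidual → StepLemmaFSResidual`** (rule φ + `term_ge_of_certFS`),
  **`dibStar_of_fseResidual : FSEResidual → ∀ x < 1, DIBStar x`**.

TYPED LADDER after gen 20: `StepFSEMax ⟹ StepFSE ⟹ FSE ⟹ FSEResidual ⟹ StepLemmaFSResidual ⟺ StepLemmaFSCore ⟺ StepLemmaFSBig ⟺ StepLemmaFS ⟺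
(∀ x < 1, DIBStar x)`.  OPEN CLASS OF T-DIB after gen 20: `1/2 < x < 1`; all sizes `≤ j`; heavy total `≤ 2j`; `≥ 2` non-empty lights, each with
`x² < g < x`, light total `≥ j + 1`; credit `> 2j`; the largest blob has gate `< 1`; AND some two non-empty blobs do not complete.
[this work]; the gluing rows served [cite: KozmaNitzan2024, Conjecture 3 (p. 15)].
-/


namespace Summit.CriticalPhenomena.PercolationContinuityZ3.Theorems

namespace Quant

namespace IndepBlob

open Finset

/-- **CONJECTURE — the floor-split step lemma on the RESIDUAL class** (T-DIB narrowed by the pairwise-completing family): the lead's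
`StepLemmaFSCore` (g18: floor `1/2 < x < 1`, gates in `[0,1]`, light sizes `≤ j`, heavy total `≤ 2j`, no heavy giant, two distinct non-empty light
blobs, light total `≥ j + 1`, no dead light, no sure blob of maximal size, credit `> 2j`, capped DIB\* rows of every one-blob deletion) restricted to
instances with SOME TWO NON-EMPTY BLOBS THAT DO NOT COMPLETE (`a k₁ + a k₂ ≤ j`).  Equivalent to `∀ x < 1, DIBStar x`
(`stepLemmaFSResidual_iff_dibStar`): the complement is `tail_ge_of_pairCompleting`.
builds on p205010 (kernel theorem, internal audit signed; external expert review pending). [this work] [status: open] -/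
@[conjecture] def StepLemmaFSResidual : Prop :=
  ∀ (κ : Type) [Fintype κ] [DecidableEq κ] (a : κ → ℕ) (g : κ → ℝ) (j : ℕ) (x : ℝ),
    1 / 2 < x → x < 1 →
    (∀ k, 0 ≤ g k ∧ g k ≤ 1) →
    (∀ k, g k < x → a k ≤ j) →
    (∑ k ∈ Finset.univ.filter (fun k => x ≤ g k), a k ≤ 2 * j) →
    (∀ k, x ≤ g k → a k ≤ j) →
    (∃ k₁ k₂, k₁ ≠ k₂ ∧ g k₁ < x ∧ 0 < a k₁ ∧ g k₂ < x ∧ 0 < a k₂) →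
    (j + 1 ≤ ∑ k ∈ Finset.univ.filter (fun k => g k < x), a k) →
    (∀ k, g k < x → 0 < a k → x ^ 2 < g k) →
    (∀ k, (∀ i, a i ≤ a k) → g k < 1) →
    (∃ k₁ k₂, k₁ ≠ k₂ ∧ 0 < a k₁ ∧ 0 < a k₂ ∧ a k₁ + a k₂ ≤ j) →
    (2 * j : ℝ) < ∑ k, (a k : ℝ) * (if x ≤ g k then g k else (g k - x ^ 2) / (1 - x)) →
    (∀ k, 0 < a k → RootDec.CappedRows (Function.update a k 0) g) →
    x ≤ ∑ W : Finset κ, (∏ k, if k ∈ W then g k else 1 - g k) * (if j + 1 ≤ ∑ k ∈ W, a k then (1 : ℝ) else 0)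

/-- **CONJECTURE FS-E on the RESIDUAL class**: the lead's closed-form conjecture of record `FSE` restricted to instances with some two non-empty
blobs that do not complete.  Implied by `FSE`; implies `StepLemmaFSResidual`, hence T-DIB. builds on p205010 (kernel theorem, internal audit signed;
external expert review pending). [this work] [status: open] -/
@[conjecture] def FSEResidual : Prop :=
  ∀ (κ : Type) [Fintype κ] [DecidableEq κ] (a : κ → ℕ) (g : κ → ℝ) (j : ℕ) (x : ℝ),
    1 / 2 < x → x < 1 →
    (∀ k, 0 ≤ g k ∧ g k ≤ 1) →
    (∀ k, g k < x → a k ≤ j) →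
    (∑ k ∈ Finset.univ.filter (fun k => x ≤ g k), a k ≤ 2 * j) →
    (∀ k, x ≤ g k → a k ≤ j) →
    (∃ k₁ k₂, k₁ ≠ k₂ ∧ g k₁ < x ∧ 0 < a k₁ ∧ g k₂ < x ∧ 0 < a k₂) →
    (j + 1 ≤ ∑ k ∈ Finset.univ.filter (fun k => g k < x), a k) →
    (∃ k₁ k₂, k₁ ≠ k₂ ∧ 0 < a k₁ ∧ 0 < a k₂ ∧ a k₁ + a k₂ ≤ j) →
    (2 * j : ℝ) < ∑ k, (a k : ℝ) * (if x ≤ g k then g k else (g k - x ^ 2) / (1 - x)) →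
    ∃ k : κ, ∃ z₁ z₀ : ℝ, x ≤ g k * z₁ + (1 - g k) * z₀ ∧
      RootDec.CertFS (Function.update a k 0) g j (a k) z₁ ∧ RootDec.CertFS (Function.update a k 0) g j 0 z₀

/-- **The pairwise-completing family is kernel**: `StepLemmaFSResidual → StepLemmaFSCore` (the other case is `tail_ge_of_pairCompleting`). [this work] -/
theorem stepLemmaFSCore_of_residual (H : StepLemmaFSResidual) : StepLemmaFSCore := by
  intro κ _ _ a g j x hx hx1 hg hlight hcorner hnogiant htwo hbig hnodead hnosure hcredit hIH
  by_cases hpc : ∃ k₁ k₂, k₁ ≠ k₂ ∧ 0 < a k₁ ∧ 0 < a k₂ ∧ a k₁ + a k₂ ≤ j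
  · exact H κ a g j x hx hx1 hg hlight hcorner hnogiant htwo hbig hnodead hnosure hpc hcredit hIH
  · push Not at hpc
    exact tail_ge_of_pairCompleting x hx.le hx1 a g j hg hlight
      (fun k l hkl hk hl => by have := hpc k l hkl hk hl; omega) hcredit

/-- The residual step lemma follows from DIB\* below one. [this work] -/
theorem stepLemmaFSResidual_of_dibStar (h : ∀ x : ℝ, x < 1 → DIBStar x) : StepLemmaFSResidual :=
  fun κ _ _ a g j x _ hx1 hg hlight _ _ _ _ _ _ _ hcredit _ => h x hx1 κ a g j hg hlight hcredit

/-- **`StepLemmaFSResidual ⟹ DIB\*` at every floor `x < 1`.** [this work] -/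
theorem dibStar_of_stepLemmaFSResidual (H : StepLemmaFSResidual) (x : ℝ) (hx1 : x < 1) : DIBStar x :=
  dibStar_of_stepLemmaFSCore (stepLemmaFSCore_of_residual H) x hx1

/-- **T-DIB ≡ the residual step lemma**: `StepLemmaFSResidual ↔ ∀ x < 1, DIBStar x`. [this work] -/
theorem stepLemmaFSResidual_iff_dibStar : StepLemmaFSResidual ↔ ∀ x : ℝ, x < 1 → DIBStar x :=
  ⟨fun H x hx => dibStar_of_stepLemmaFSResidual H x hx, stepLemmaFSResidual_of_dibStar⟩

/-- `FSE → FSEResidual` (restriction). [this work] -/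
theorem fseResidual_of_fse (H : FSE) : FSEResidual :=
  fun κ _ _ a g j x hx hx1 hg hlight hcorner hnogiant htwo hbig _ hcredit =>
    H κ a g j x hx hx1 hg hlight hcorner hnogiant htwo hbig hcredit

/-- **`FSEResidual ⟹ StepLemmaFSResidual`** (rule φ + `term_ge_of_certFS` on both branches, as in the lead's `stepLemmaFSBig_of_fse`). [this work] -/
theorem stepLemmaFSResidual_of_fseResidual (H : FSEResidual) : StepLemmaFSResidual := by
  intro κ _ _ a g j x hx hx1 hg hlight hcorner hnogiant htwo hbig _ _ hpc hcredit _
  obtain ⟨k, z₁, z₀, hxz, c₁, c₀⟩ := H κ a g j x hx hx1 hg hlight hcorner hnogiant htwo hbig hpc hcredit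
  have h₁ := RootDec.term_ge_of_certFS (Function.update a k 0) g j (a k) z₁ hg c₁
  have h₀ := RootDec.term_ge_of_certFS (Function.update a k 0) g j 0 z₀ hg c₀
  have h₁' : z₁ ≤ ∑ W : Finset κ, (∏ k', if k' ∈ W then g k' else 1 - g k') *
      (if j + 1 ≤ (0 + a k) + ∑ k' ∈ W, Function.update a k 0 k' then (1 : ℝ) else 0) := by
    rw [zero_add]; exact h₁
  have key := RootDec.term_ge_of_floorSplit 0 a g j k x z₁ z₀ (hg k) h₁' h₀ hxz
  exact key.trans (le_of_eq (Finset.sum_congr rfl fun W _ => by rw [zero_add]))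

/-- **`FSEResidual ⟹ DIB\*` at every floor `x < 1`** — proving the closed-form conjecture on the residual class closes T-DIB. [this work] -/
theorem dibStar_of_fseResidual (H : FSEResidual) (x : ℝ) (hx1 : x < 1) : DIBStar x :=
  dibStar_of_stepLemmaFSResidual (stepLemmaFSResidual_of_fseResidual H) x hx1

end IndepBlob

end Quant

end Summit.CriticalPhenomena.PercolationContinuityZ3.Theorems
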